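/-
Copyright (c) 2026 the pub-hodgecm-mathlib formalisation cell (harness21).  Prover seat hodgecm-mathlib-F0P2-p10 (g3), Track B «K2-LIT»,
#184♮ = hLiu418 = `stmt-HodgeConjecture-24832`; FACE-D₀ (B1c′) chain of K2Liu-p02 (g9), FILE 2 (LEAD F0P6-plan (g15) BATCH #183 (1), 2026-09-05T00:25:41Z).
THEOREMS ONLY (no `def`, no `instance`, no notation, no named-fact hypothesis, no `sorry`).
-/
import Summits.HodgeConjecture.HodgeConjecture.Theorems.K2LiuDoubledParabolicCayleyModel   -- ★ (K-f) (imports ★ (K-b)(K-d) `K2LiuDoubledDarbouxDeltaBlocks`, ★ (K-e), ★ `K2LiuCayleyMoverFin`, ★ (K-a) `K2LiuResAutDarboux`)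
import Literature.NumberTheory.K2Lit.DoubledLineThetaKernel                                  -- ★ `dD`, `toDiagA`, `coe_toDiagA` (+ ★ Liu2021 `TW`, `JW`, line splitting data)
import Literature.NumberTheory.K2Lit.SiegelDoubledUnipotent                                   -- ★ `unipDelta`, `mem_unipDelta_iff_blocks`
import Literature.NumberTheory.Weil1964.AdelicMetaplecticRationalLift                         -- ★ `spMatrixReindex`, `spReindex_transportSp`
import HarnessLib

/-!
# Crux `HLiu418`, FACE-D₀ (B1c′), FILE 2 — `K2LiuLinePairCayleySiegel`: THE SIEGEL PARABOLIC `P_Δ(𝔸)` OF THE DOUBLED UNITARY GROUP INSIDE THE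
# LINE PAIR `(U(𝔻), U(⟨a′⟩))`, IN THE `κ′`-MODEL — FILE 2a (§0–§3): the standard-Darboux matrix of the line embedding and the line Cayley mover `κ′ ∈ Sp_{2n″}(L⁺)`
# (§4 = FILE 2b `…Model`, §5 = FILE 2c `…Unipotent`; the 400-line cut)

Cell `hodgecm-mathlib`, crux item hLiu418 = `stmt-HodgeConjecture-24832` (helper lane `--supports … --as helper`, count-neutral), route of record `HCCMUnconditional`;
squad K2 ∕ K2Liu, road `K2_Liu`, socket #42F′ FACE-D₀ `h2₂`, chain (B1c′-1) FILE 1 `K2LiuMetaplecticUnipotentRigidity` (K2Liu-p02) → FILE 2 (this) → FILE 3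
`K2LiuLinePairKappaModelOnUnipotents` (K2Liu-p02), (B1c′-2b) `K2LiuFinChirpLocalGramReading` (K2E3-p23).

THE SETTING.  `H = U(𝔻)`, `𝔻 = 𝕍 ⊕ (−𝕍)` the doubled hermitian space of the datum `(e, dV, dW)` (★ `DoubledUnitaryGlobalSplittingData`: `HA`, `blk`, `IsSiegelDelta`,
`toSpD = ι^𝔻`, `gramDA = T^𝔻 ⊗ 1`).  The FACE pairs `H` with the hermitian LINE `⟨a′⟩` (`a′ ∈ (L⁺)ˣ`, ★ Liu2021 `TW a′`): the big symplectic space is `Res(𝔻 ⊗ ⟨a′⟩)` with Gram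
`T₁ := adelicGram e₁ (diag dD) (a′) = reindex e₁ e₁ ((diag dD ⊗ 1) ⊗ₖ (a′))` along an enumeration `e₁ : Fin (n+n) × Fin 1 ≃ Fin n″`, and `h ∈ H(𝔸)` acts through
`j(h) := toSp (adelicInl (toDiagA h)) ∈ Sp(𝕎₁)` (★ `UnitaryDualPairSplittingDatum.toSp = spReindex e₁ ∘ adelicPairToSymplectic`, ★ `toDiagA : H(𝔸) ≃* U(diag dD)(𝔸)` the
identity on matrices).  Write `U h := untransportSp T^𝔻 (ι^𝔻 h)` (★ (K-b): the block matrix `(re h, d • im h (T^𝔻)⁻¹; T^𝔻 im h, T^𝔻 re h (T^𝔻)⁻¹)`), `κ_n := reindex σ σ κ`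
(`σ = e₂ ⊕ e₂`, ★ `K2LiuCayleyMoverFin`), `D_c := (1, 0; 0, c • 1)`, `e₁′ := prodUnique⁻¹ ≫ e₁ : Fin (n+n) ≃ Fin n″`, `ρ := e₁′ ⊕ e₁′`.
* §0 block algebra over a commutative ring: `D_c · (P, Q; R, S) · D_{c′} = (P, c′ • Q; c • R, S)` (`c c′ = 1`); **`diag_conj_mem_symplecticGroup`** — `D_c X D_{c′} ∈ Sp` for
  `X ∈ Sp` (`D_{c′} J D_{c′}ᵀ = c′ • J`: a similitude conjugation); reindexing along `ε ⊕ ε`.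
* §1 plumbing: **`untransportSp_spReindex`** (`untransportSp (reindex T) (spReindex e g) = spMatrixReindex e (untransportSp T g)`, from ★ `spReindex_transportSp`);
  **`coe_untransportSp_adelicPairToSymplectic`** — ★ (K-b) for a PAIR datum: the standard-Darboux matrix of `adelicPairToSymplectic x`, `x ∈ G₁(𝔸) ≤ GL_{N×M}(𝔸_L)`, is
  `(re x, d • im x T⁻¹; T im x, T re x T⁻¹)` at `T = T_V ⊗ₖ T_W` (★ (K-a) `darboux_resAut_darboux_symm` verbatim); the kronecker-with-`Fin 1` bookkeeping
  (`x ⊗ₖ 1 = reindex p⁻¹ p⁻¹ x`, `(diag dD ⊗ 1) ⊗ₖ (a′) = reindex p⁻¹ p⁻¹ (a′ • T^𝔻 ⊗ 1)`, `p = prodUnique`; `diag dD = T^𝔻` by ★ `gramD_eq_diagonal_cm`).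
* §2 **`coe_untransportSp_toSp_line`** (line (K-b)): `untransportSp T₁ (j h) = reindex ρ ρ (D_{a′} · U h · D_{a′⁻¹})` for EVERY `h ∈ H(𝔸)` — the `im`-blocks of ★ (K-b) scale by `a′^{±1}`.
* §3 **`lineCayleyMover_mem_symplecticGroup`**: `κ′ := reindex ρ ρ (D_{a′} κ_n D_{a′⁻¹}) ∈ Sp_{2n″}(L⁺)` (rational), and its adelic image.
* §4 (FILE 2b `K2LiuLinePairCayleySiegelModel`) **`coe_lineCayleyMover_conj_untransportSp_toSp_line`** — the `κ′`-MODEL of `P_Δ(𝔸)` in the line pair: for `h ∈ P_Δ(𝔸)`,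
  `κ′_𝔸 · untransportSp T₁ (j h) · κ′_𝔸⁻¹ = reindex ρ ρ (A, 0; a′ • C, A′)` with ★ (K-d)'s blocks `A = D₂ Res(b₁₁ − b₂₁) D₂⁻¹`, `C = J₂ Res(b₂₁ − b₁₂) D₂⁻¹`,
  `A′ = J₂ Res(h|_Δ) J₂⁻¹` VERBATIM; (FILE 2c `K2LiuLinePairCayleySiegelUnipotent`) **`ratSp_lineCayleyMover_conj_toSp_mem_siegelParabolicPi`** — the membership letter `hj` of ★ `adelicSiegelLiftConj'`:
  `ratSp κ′ · j(p) · (ratSp κ′)⁻¹ ∈ P_𝕐(T₁)` for `p ∈ P_Δ(𝔸)` (★ (K-e) `transportSp_mem_siegelParabolicPi_of_toBlocks₁₂_eq_zero`).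
* §5 (FILE 2c) **`coe_lineCayleyMover_conj_untransportSp_toSp_line_of_mem_unipDelta`** ((B1c′-2a) folded in): for `u ∈ N_Δ(𝔸)` the `κ′`-model is the LOWER UNIPOTENT
  `reindex ρ ρ (1, 0; a′ • (J₂ Res(−2 X_u) D₂⁻¹), 1)`, `X_u = (blk u)₁₂` (`b₁₁ − b₂₁ = 1`, `b₂₁ − b₁₂ = −2X_u`, `u|_Δ = 1` on `N_Δ`, ★ `mem_unipDelta_iff_blocks`).
[Kudla1994, §2–§3 (the doubled space, its Siegel parabolic, the Cayley element)] [GelbartRogawski1991, §3.1 Prop. 3.1.1 p. 455] [HarrisKudlaSweet1996, §1 (1.8), (1.14)–(1.15)]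
[Weil1964, Chap. I n° 13 p. 160, Chap. III n° 46 p. 201] [MoeglinVignerasWaldspurger1987, Chap. 2 II.2].
HONEST LABEL.  Count-neutral helper, closes no socket by itself: `HC_CM` is proved only modulo the 7 printed citations (2 remaining named inputs: hLiu418 =
`stmt-HodgeConjecture-24832`, h413 = `stmt-HodgeConjecture-24833`) until rung 0 closes; FACE-D₀ `h2₂` is NOT discharged by this file (FILE 3 + (B1c′-2b) + S-letters tie).

## References
* [Kudla1994] S. S. Kudla, *Splitting metaplectic covers of dual reductive pairs*, Israel J. Math. 87 (1994): §2–§3.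
* [GelbartRogawski1991] S. Gelbart, J. Rogawski, Invent. Math. 105 (1991): §3.1 Prop. 3.1.1 p. 455.
* [HarrisKudlaSweet1996] M. Harris, S. Kudla, W. J. Sweet, J. AMS 9 (1996): §1.   * [Weil1964] A. Weil, Acta Math. 111 (1964): Chap. I n° 13, Chap. III n° 46.
* [MoeglinVignerasWaldspurger1987] C. Mœglin, M.-F. Vignéras, J.-L. Waldspurger, LNM 1291 (1987): Chap. 2 II.2.
-/

set_option autoImplicit false
-- the mandated namespace repeats the single-problem summit's segment (`HodgeConjecture.HodgeConjecture`)
set_option linter.dupNamespace false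

noncomputable section

open scoped Matrix Kronecker
open NumberField IsDedekindDomain

namespace Summit.HodgeConjecture.HodgeConjecture.Cruxes.HLiu418.K2LiuLinePairCayleySiegel

open Literature.NumberTheory.Automorphic Literature.NumberTheory.Automorphic.UnitaryGroup
open Literature.NumberTheory.Automorphic.UnitaryGroup.QuadraticCoordinates
open Literature.NumberTheory.Automorphic.UnitaryGroup.SpTransport
open Literature.RepresentationTheory.HeisenbergGroup Literature.RepresentationTheory.HeisenbergGroup.SymplecticMatrix
open Literature.NumberTheory.GelbartRogawski1991 Literature.NumberTheory.GelbartRogawski1991.GRConstruction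
open Literature.NumberTheory.GelbartRogawski1991.UnitaryDualPair
open Literature.NumberTheory.Weil1964
open Literature.NumberTheory.Automorphic.Liu2021 Literature.NumberTheory.Automorphic.Liu2021.Def411WeilCarriers
open Literature.NumberTheory.K2Lit.DoubledLineTheta Literature.NumberTheory.K2Lit.SiegelDoubled
open Summit.HodgeConjecture.HodgeConjecture.Cruxes.HLiu418.K2LiuResAutDarboux (darboux_resAut_darboux_symm)
open Summit.HodgeConjecture.HodgeConjecture.Cruxes.HLiu418.K2LiuDoubledDarbouxDeltaBlocks
  (reindex_sumCongr_fromBlocks coe_untransportSp_toSpD coe_cayleyMover_conj_untransportSp_toSpD)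
open Summit.HodgeConjecture.HodgeConjecture.Cruxes.HLiu418.K2LiuCayleyDeltaSiegelTransfer (transportSp_mem_siegelParabolicPi_of_toBlocks₁₂_eq_zero)
open Summit.HodgeConjecture.HodgeConjecture.Cruxes.HLiu418.K2LiuCayleyMoverFin (reindex_cayleyMoverMatrix_mem_symplecticGroup reindex_cayleyMoverMatrix_map)

/-! ## §0 Block algebra over a commutative ring -/

section Generic

variable {α : Type*} [CommRing α] {ι : Type*} [Fintype ι] [DecidableEq ι]

/-- **`D_c · (P, Q; R, S) · D_{c′} = (P, c′ • Q; c • R, S)`** for `D_c = (1, 0; 0, c • 1)` and `c c′ = 1`. [cite: MoeglinVignerasWaldspurger1987, Chap. 2 II.2] -/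
theorem diag_mul_fromBlocks_mul_diag {c c' : α} (hcc' : c * c' = 1) (P Q R S : Matrix ι ι α) :
    Matrix.fromBlocks 1 0 0 (c • (1 : Matrix ι ι α)) * Matrix.fromBlocks P Q R S * Matrix.fromBlocks 1 0 0 (c' • (1 : Matrix ι ι α)) =
      Matrix.fromBlocks P (c' • Q) (c • R) S := by
  simp only [Matrix.fromBlocks_multiply, Matrix.one_mul, Matrix.mul_one, Matrix.zero_mul, Matrix.mul_zero, add_zero, zero_add,
    Matrix.smul_mul, Matrix.mul_smul, smul_smul, mul_comm c' c, hcc', one_smul]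

/-- `D_{c′} · J · D_{c′}ᵀ = c′ • J` (`D_{c′}` is a symplectic similitude with multiplier `c′`). [cite: MoeglinVignerasWaldspurger1987, Chap. 2 II.2] -/
theorem diag_mul_J_mul_diag_transpose (c' : α) :
    Matrix.fromBlocks 1 0 0 (c' • (1 : Matrix ι ι α)) * Matrix.J ι α * (Matrix.fromBlocks 1 0 0 (c' • (1 : Matrix ι ι α)))ᵀ = c' • Matrix.J ι α := by
  rw [Matrix.J, Matrix.fromBlocks_transpose, Matrix.fromBlocks_multiply, Matrix.fromBlocks_multiply, Matrix.fromBlocks_smul]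
  simp only [Matrix.transpose_one, Matrix.transpose_zero, Matrix.transpose_smul, Matrix.mul_zero,
    add_zero, zero_add, Matrix.mul_smul, Matrix.mul_neg, smul_zero, smul_neg, mul_one, neg_zero]

/-- **SIMILITUDE CONJUGATION PRESERVES `Sp`**: `X ∈ Sp_{2ι}(α)`, `c c′ = 1` ⇒ `D_c · X · D_{c′} ∈ Sp_{2ι}(α)` (`A J Aᵀ = c′ c • J = J`).
[cite: MoeglinVignerasWaldspurger1987, Chap. 2 II.2] -/
theorem diag_conj_mem_symplecticGroup {c c' : α} (hcc' : c * c' = 1) {X : Matrix (ι ⊕ ι) (ι ⊕ ι) α} (hX : X ∈ Matrix.symplecticGroup ι α) :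
    Matrix.fromBlocks 1 0 0 (c • (1 : Matrix ι ι α)) * X * Matrix.fromBlocks 1 0 0 (c' • (1 : Matrix ι ι α)) ∈ Matrix.symplecticGroup ι α := by
  rw [SymplecticGroup.mem_iff] at hX ⊢
  have h1 : Matrix.fromBlocks 1 0 0 (c • (1 : Matrix ι ι α)) * X * Matrix.fromBlocks 1 0 0 (c' • (1 : Matrix ι ι α)) * Matrix.J ι α *
      (Matrix.fromBlocks 1 0 0 (c • (1 : Matrix ι ι α)) * X * Matrix.fromBlocks 1 0 0 (c' • (1 : Matrix ι ι α)))ᵀ =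
      Matrix.fromBlocks 1 0 0 (c • (1 : Matrix ι ι α)) * (X * (Matrix.fromBlocks 1 0 0 (c' • (1 : Matrix ι ι α)) * Matrix.J ι α *
        (Matrix.fromBlocks 1 0 0 (c' • (1 : Matrix ι ι α)))ᵀ) * Xᵀ) * (Matrix.fromBlocks 1 0 0 (c • (1 : Matrix ι ι α)))ᵀ := by
    simp only [Matrix.transpose_mul, Matrix.mul_assoc]
  rw [h1, diag_mul_J_mul_diag_transpose, Matrix.mul_smul, Matrix.smul_mul, hX, Matrix.mul_smul, Matrix.smul_mul, diag_mul_J_mul_diag_transpose, smul_smul,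
    mul_comm c' c, hcc', one_smul]

omit [DecidableEq ι] in
/-- reindexing along `ε ⊕ ε` commutes with products (three factors). [folklore] -/
theorem reindex_sumCongr_mul_mul {m : Type*} [Fintype m] [DecidableEq m] (ε : ι ≃ m) (A B C : Matrix (ι ⊕ ι) (ι ⊕ ι) α) :
    Matrix.reindex (ε.sumCongr ε) (ε.sumCongr ε) (A * B * C) =
      Matrix.reindex (ε.sumCongr ε) (ε.sumCongr ε) A * Matrix.reindex (ε.sumCongr ε) (ε.sumCongr ε) B * Matrix.reindex (ε.sumCongr ε) (ε.sumCongr ε) C := by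
  simp only [Matrix.reindex_apply, Matrix.submatrix_mul_equiv]

/-- a kronecker product with the `1 × 1` identity is the re-enumeration along `prodUnique`: `x ⊗ₖ 1 = reindex p⁻¹ p⁻¹ x`. [folklore] -/
theorem kronecker_one_fin_one {m : Type*} (x : Matrix m m α) :
    x ⊗ₖ (1 : Matrix (Fin 1) (Fin 1) α) = Matrix.reindex (Equiv.prodUnique m (Fin 1)).symm (Equiv.prodUnique m (Fin 1)).symm x := by
  ext ⟨i, a⟩ ⟨j, b⟩
  rw [Subsingleton.elim a 0, Subsingleton.elim b 0]
  simp [Matrix.kroneckerMap_apply, Matrix.reindex_apply]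

/-- a kronecker product with a `1 × 1` scalar matrix: `x ⊗ₖ !![c] = reindex p⁻¹ p⁻¹ (c • x)`. [folklore] -/
theorem kronecker_of_fin_one {m : Type*} (x : Matrix m m α) (c : α) :
    x ⊗ₖ (!![c] : Matrix (Fin 1) (Fin 1) α) = Matrix.reindex (Equiv.prodUnique m (Fin 1)).symm (Equiv.prodUnique m (Fin 1)).symm (c • x) := by
  ext ⟨i, a⟩ ⟨j, b⟩
  rw [Subsingleton.elim a 0, Subsingleton.elim b 0]
  simp [Matrix.kroneckerMap_apply, Matrix.reindex_apply, mul_comm]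

omit [CommRing α] [Fintype ι] [DecidableEq ι] in
/-- re-enumerating a block matrix along `ε` on BOTH the row∕column index of each block: `reindex (ε ⊕ ε) (fromBlocks (reindex …))`. [folklore] -/
theorem fromBlocks_reindex {m : Type*} (ε : ι ≃ m) (P Q R S : Matrix ι ι α) :
    Matrix.fromBlocks (Matrix.reindex ε ε P) (Matrix.reindex ε ε Q) (Matrix.reindex ε ε R) (Matrix.reindex ε ε S) =
      Matrix.reindex (ε.sumCongr ε) (ε.sumCongr ε) (Matrix.fromBlocks P Q R S) := by
  ext (i | i) (j | j) <;> rfl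

end Generic

/-! ## §1 Plumbing: `untransportSp` under `spReindex`; the standard-Darboux matrix of a pair datum -/

section Plumbing

/-- **`untransportSp` COMMUTES WITH RE-ENUMERATION**: `untransportSp (reindex e e T) (spReindex e T g) = spMatrixReindex e (untransportSp T g)` (★ `spReindex_transportSp` read
backwards through ★ `transportSp_untransportSp` ∕ `untransportSp_transportSp`). [folklore] -/
theorem untransportSp_spReindex {K : Type*} [CommRing K] {ι ι' : Type*} [Fintype ι] [DecidableEq ι] [Fintype ι'] [DecidableEq ι'] (e : ι ≃ ι')
    (T : Matrix ι ι K) (hT : IsUnit T.det) (hT' : IsUnit (Matrix.reindex e e T).det) (g : symplecticGroup (polar (Matrix.toLinearMap₂' K T))) :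
    untransportSp (Matrix.reindex e e T) hT' (spReindex e T g) = spMatrixReindex e (untransportSp T hT g) := by
  have h1 := spReindex_transportSp e T hT (untransportSp T hT g)
  rw [transportSp_untransportSp] at h1
  rw [h1]
  exact untransportSp_transportSp _ _ _

variable (F E : Type) [Field F] [NumberField F] [Field E] [NumberField E] [Algebra F E] (c : E ≃ₐ[F] E) (N M : ℕ)

/-- **THE STANDARD-DARBOUX MATRIX OF A PAIR DATUM** (★ (K-b) for `G₁ = U(J_V ⊗ J_W)`): for `x ∈ G₁(𝔸_F) ≤ GL_{N×M}(𝔸_E)` and `T = T_V ⊗ₖ T_W ⊗ 1` with `det T` a unit,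
`untransportSp T (adelicPairToSymplectic x) = (re x, d • im x T⁻¹; T im x, T re x T⁻¹)` (`adelicPairToSymplectic = toSymplectic (N × M)`, whose underlying automorphism is `resAut x`;
★ (K-a) `darboux_resAut_darboux_symm`). [cite: GelbartRogawski1991, §3.1 p. 454] [cite: Kudla1994, §2] -/
theorem coe_untransportSp_adelicPairToSymplectic [Algebra.IsQuadraticExtension F E] {δ : E} (hcδ : c δ = -δ) (hδ : δ ≠ 0) {d : F}
    (hd : δ * δ = algebraMap F E d) {TV : Matrix (Fin N) (Fin N) F} {TW : Matrix (Fin M) (Fin M) F} (hV : TV.IsSymm) (hW : TW.IsSymm)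
    {JV : Matrix (Fin N) (Fin N) E} {JW : Matrix (Fin M) (Fin M) E} (hJV : JV = TV.map (algebraMap F E)) (hJW : JW = TW.map (algebraMap F E))
    (hT : IsUnit (TV.map (algebraMap F (AdeleRing (𝓞 F) F)) ⊗ₖ TW.map (algebraMap F (AdeleRing (𝓞 F) F))).det)
    (x : UnitaryGroup.adelicPair F E c N M JV JW) :
    ((untransportSp (TV.map (algebraMap F (AdeleRing (𝓞 F) F)) ⊗ₖ TW.map (algebraMap F (AdeleRing (𝓞 F) F))) hT
          (UnitaryGroup.adelicPairToSymplectic F E c N M hcδ hδ hd hV hW hJV hJW x) : Matrix.symplecticGroup (Fin N × Fin M) (AdeleRing (𝓞 F) F)) :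
        Matrix ((Fin N × Fin M) ⊕ (Fin N × Fin M)) ((Fin N × Fin M) ⊕ (Fin N × Fin M)) (AdeleRing (𝓞 F) F)) =
      Matrix.fromBlocks
        (((x : GL (Fin N × Fin M) (AdeleRing (𝓞 E) E)) : Matrix (Fin N × Fin M) (Fin N × Fin M) (AdeleRing (𝓞 E) E)).map
          (re (quadraticAdeleEquiv F E c hcδ hδ).toAddEquiv))
        (algebraMap F (AdeleRing (𝓞 F) F) d •
          ((((x : GL (Fin N × Fin M) (AdeleRing (𝓞 E) E)) : Matrix (Fin N × Fin M) (Fin N × Fin M) (AdeleRing (𝓞 E) E)).map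
              (im (quadraticAdeleEquiv F E c hcδ hδ).toAddEquiv)) *
            (TV.map (algebraMap F (AdeleRing (𝓞 F) F)) ⊗ₖ TW.map (algebraMap F (AdeleRing (𝓞 F) F)))⁻¹))
        ((TV.map (algebraMap F (AdeleRing (𝓞 F) F)) ⊗ₖ TW.map (algebraMap F (AdeleRing (𝓞 F) F))) *
          ((x : GL (Fin N × Fin M) (AdeleRing (𝓞 E) E)) : Matrix (Fin N × Fin M) (Fin N × Fin M) (AdeleRing (𝓞 E) E)).map
            (im (quadraticAdeleEquiv F E c hcδ hδ).toAddEquiv))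
        ((TV.map (algebraMap F (AdeleRing (𝓞 F) F)) ⊗ₖ TW.map (algebraMap F (AdeleRing (𝓞 F) F))) *
          ((x : GL (Fin N × Fin M) (AdeleRing (𝓞 E) E)) : Matrix (Fin N × Fin M) (Fin N × Fin M) (AdeleRing (𝓞 E) E)).map
            (re (quadraticAdeleEquiv F E c hcδ hδ).toAddEquiv) *
          (TV.map (algebraMap F (AdeleRing (𝓞 F) F)) ⊗ₖ TW.map (algebraMap F (AdeleRing (𝓞 F) F)))⁻¹) := by
  rw [Matrix.ext_iff_mulVec]
  intro u
  rw [coe_untransportSp, untransportMatrix_mulVec]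
  exact darboux_resAut_darboux_symm (isQuadraticCoordinates_adele E c hcδ hδ hd) _ hT (x : GL (Fin N × Fin M) (AdeleRing (𝓞 E) E)) u

end Plumbing

/-! ## §2 The line (K-b): the standard-Darboux matrix of `j(h) = toSp (adelicInl (toDiagA h))` -/

section Line

open Summit.HodgeConjecture.HodgeConjecture.Cruxes.HLiu418.K2LiuDoubledDarbouxDeltaBlocks (reindex_mul_reindex reindex_smul')

variable (L : Type) [Field L] [NumberField L] [IsCMField L]
variable {N M n : ℕ} (e : Fin N × Fin M ≃ Fin n)
  (dV : Fin N → L) (hdV : ∀ i, IsCMField.complexConj L (dV i) = dV i) (hdV0 : ∀ i, dV i ≠ 0)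
  (dW : Fin M → L) (hdW : ∀ i, IsCMField.complexConj L (dW i) = dW i) (hdW0 : ∀ i, dW i ≠ 0)
variable {n'' : ℕ} (e₁ : Fin (n + n) × Fin 1 ≃ Fin n'') (a' : (↥(maximalRealSubfield L))ˣ)

/-- a generic re-enumeration sentence: `reindex (η ⊕ η) (fromBlocks (reindex ε ε ·)) = reindex ((ε ≫ η) ⊕ (ε ≫ η)) (fromBlocks ·)`. [folklore] -/
theorem reindex_sumCongr_fromBlocks_reindex {α : Type*} {ι m k : Type*} (ε : ι ≃ m) (η : m ≃ k) (P Q R S : Matrix ι ι α) :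
    Matrix.reindex (η.sumCongr η) (η.sumCongr η)
        (Matrix.fromBlocks (Matrix.reindex ε ε P) (Matrix.reindex ε ε Q) (Matrix.reindex ε ε R) (Matrix.reindex ε ε S)) =
      Matrix.reindex ((ε.trans η).sumCongr (ε.trans η)) ((ε.trans η).sumCongr (ε.trans η)) (Matrix.fromBlocks P Q R S) := by
  ext (i | i) (j | j) <;> rfl

/-- `realDiagonal (dD) = T^𝔻` (★ `gramD_eq_diagonal_cm`: both are the diagonal matrix `(t₀ ⊕ (−t₀)) ∘ e₂⁻¹`). [cite: GelbartRogawski1991, §3.1 Prop. 3.1.1 p. 455] -/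
theorem realDiagonal_dD_eq_gramD : realDiagonal L (dD L e dV hdV dW hdW) (dD_conj L e dV hdV dW hdW) = gramD L e dV hdV dW hdW := by
  rw [gramD_eq_diagonal_cm]
  unfold realDiagonal
  congr 1

/-- `realDiagonal (dD) ⊗ 1 = T^𝔻 ⊗ 1 = gramDA`. [cite: GelbartRogawski1991, §3.1 Prop. 3.1.1 p. 455] -/
theorem realDiagonal_dD_map_eq_gramDA :
    (realDiagonal L (dD L e dV hdV dW hdW) (dD_conj L e dV hdV dW hdW)).map (algebraMap (Fp L) (AdeleRing (𝓞 (Fp L)) (Fp L))) =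
      gramDA L e dV hdV dW hdW := by
  rw [realDiagonal_dD_eq_gramD]; rfl

omit [IsCMField L] in
/-- `(a′) ⊗ 1 = !![a′ ⊗ 1]`. [folklore] -/
theorem TW_map (f : Fp L →+* AdeleRing (𝓞 (Fp L)) (Fp L)) : (TW (Fp L) a').map f = !![f (a' : Fp L)] := by
  ext i j
  fin_cases i; fin_cases j
  rfl

/-- the pair Gram matrix of the line datum is the re-enumerated `a′ • T^𝔻 ⊗ 1`. [cite: GelbartRogawski1991, §3.1 Prop. 3.1.1 p. 455] -/
theorem lineGram_eq_reindex :
    (realDiagonal L (dD L e dV hdV dW hdW) (dD_conj L e dV hdV dW hdW)).map (algebraMap (Fp L) (AdeleRing (𝓞 (Fp L)) (Fp L))) ⊗ₖ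
        (TW (Fp L) a').map (algebraMap (Fp L) (AdeleRing (𝓞 (Fp L)) (Fp L))) =
      Matrix.reindex (Equiv.prodUnique (Fin (n + n)) (Fin 1)).symm (Equiv.prodUnique (Fin (n + n)) (Fin 1)).symm
        (algebraMap (Fp L) (AdeleRing (𝓞 (Fp L)) (Fp L)) (a' : Fp L) • gramDA L e dV hdV dW hdW) := by
  rw [TW_map, kronecker_of_fin_one, realDiagonal_dD_map_eq_gramDA]

include hdV0 hdW0 in
/-- the inverse of the pair Gram matrix: `(p⁻¹ (a′ • T^𝔻))⁻¹ = p⁻¹ (a′⁻¹ • (T^𝔻)⁻¹)`. [cite: GelbartRogawski1991, §3.1 Prop. 3.1.1 p. 455] -/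
theorem lineGram_inv_eq_reindex :
    ((realDiagonal L (dD L e dV hdV dW hdW) (dD_conj L e dV hdV dW hdW)).map (algebraMap (Fp L) (AdeleRing (𝓞 (Fp L)) (Fp L))) ⊗ₖ
        (TW (Fp L) a').map (algebraMap (Fp L) (AdeleRing (𝓞 (Fp L)) (Fp L))))⁻¹ =
      Matrix.reindex (Equiv.prodUnique (Fin (n + n)) (Fin 1)).symm (Equiv.prodUnique (Fin (n + n)) (Fin 1)).symm
        (algebraMap (Fp L) (AdeleRing (𝓞 (Fp L)) (Fp L)) ((a'⁻¹ : (↥(maximalRealSubfield L))ˣ) : Fp L) • (gramDA L e dV hdV dW hdW)⁻¹) := by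
  rw [lineGram_eq_reindex]
  apply Matrix.inv_eq_left_inv
  rw [reindex_mul_reindex, smul_mul_smul, ← map_mul, ← Units.val_mul, inv_mul_cancel, Units.val_one, map_one, one_smul,
    Matrix.nonsing_inv_mul _ (isUnit_det_gramDA L e dV hdV hdV0 dW hdW hdW0), Matrix.reindex_apply, Matrix.submatrix_one_equiv]

include hdV0 hdW0 in
set_option maxHeartbeats 400000 in
-- measured: default 200000 RED (`whnf` timeout elaborating the line datum's `toSp` statement), 400000 GREEN
/-- **THE LINE (K-b): THE STANDARD-DARBOUX MATRIX OF `j(h)`.**  For EVERY `h ∈ H(𝔸)`, with `U h = untransportSp T^𝔻 (ι^𝔻 h)` (★ (K-b) `coe_untransportSp_toSpD`),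
`D_c = (1, 0; 0, c • 1)`, `e₁′ = prodUnique⁻¹ ≫ e₁`, `ρ = e₁′ ⊕ e₁′`:  `untransportSp T₁ (toSp (adelicInl (toDiagA h))) = reindex ρ ρ (D_{a′} · U h · D_{a′⁻¹})` — the `(re, im)`-blocks of
★ (K-b) at the Gram matrix `a′ T^𝔻`, whose `im`-blocks scale by `a′^{±1}`.  The proofs `hT₁ hV hW hJV hJW` and the matrix `JW` are the consumer's (any).
[cite: GelbartRogawski1991, §3.1 Prop. 3.1.1 p. 455] [cite: Kudla1994, §2] [cite: HarrisKudlaSweet1996, §1 (1.14)–(1.15)] -/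
theorem coe_untransportSp_toSp_line
    (hT₁ : IsUnit (adelicGram (Fp L) e₁ (realDiagonal L (dD L e dV hdV dW hdW) (dD_conj L e dV hdV dW hdW)) (TW (Fp L) a')).det)
    (JW : Matrix (Fin 1) (Fin 1) L) (hV : (realDiagonal L (dD L e dV hdV dW hdW) (dD_conj L e dV hdV dW hdW)).IsSymm) (hW : (TW (Fp L) a').IsSymm)
    (hJV : Matrix.diagonal (dD L e dV hdV dW hdW) = (realDiagonal L (dD L e dV hdV dW hdW) (dD_conj L e dV hdV dW hdW)).map (algebraMap (Fp L) L))
    (hJW : JW = (TW (Fp L) a').map (algebraMap (Fp L) L)) (h : HA L e dV hdV dW hdW) :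
    ((untransportSp (adelicGram (Fp L) e₁ (realDiagonal L (dD L e dV hdV dW hdW) (dD_conj L e dV hdV dW hdW)) (TW (Fp L) a')) hT₁
          (toSp (Fp L) L (IsCMField.complexConj L) (n + n) 1 e₁ (Matrix.diagonal (dD L e dV hdV dW hdW)) JW
            (complexConj_imagUnit L) (imagUnit_ne_zero L) (imagUnit_mul_self L) hV hW hJV hJW
            (UnitaryGroup.adelicInl (Fp L) L (IsCMField.complexConj L) (n + n) 1 (Matrix.diagonal (dD L e dV hdV dW hdW)) JW
              (toDiagA L e dV hdV dW hdW h))) : Matrix.symplecticGroup (Fin n'') (AdeleRing (𝓞 (Fp L)) (Fp L))) :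
        Matrix (Fin n'' ⊕ Fin n'') (Fin n'' ⊕ Fin n'') (AdeleRing (𝓞 (Fp L)) (Fp L))) =
      Matrix.reindex (((Equiv.prodUnique (Fin (n + n)) (Fin 1)).symm.trans e₁).sumCongr ((Equiv.prodUnique (Fin (n + n)) (Fin 1)).symm.trans e₁))
          (((Equiv.prodUnique (Fin (n + n)) (Fin 1)).symm.trans e₁).sumCongr ((Equiv.prodUnique (Fin (n + n)) (Fin 1)).symm.trans e₁))
        (Matrix.fromBlocks 1 0 0 (algebraMap (Fp L) (AdeleRing (𝓞 (Fp L)) (Fp L)) (a' : Fp L) • (1 : Matrix (Fin (n + n)) (Fin (n + n)) _)) *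
          ((untransportSp (gramDA L e dV hdV dW hdW) (isUnit_det_gramDA L e dV hdV hdV0 dW hdW hdW0) (toSpD L e dV hdV dW hdW h) :
              Matrix.symplecticGroup (Fin (n + n)) (AdeleRing (𝓞 (Fp L)) (Fp L))) :
            Matrix (Fin (n + n) ⊕ Fin (n + n)) (Fin (n + n) ⊕ Fin (n + n)) (AdeleRing (𝓞 (Fp L)) (Fp L))) *
          Matrix.fromBlocks 1 0 0 (algebraMap (Fp L) (AdeleRing (𝓞 (Fp L)) (Fp L)) ((a'⁻¹ : (↥(maximalRealSubfield L))ˣ) : Fp L) •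
            (1 : Matrix (Fin (n + n)) (Fin (n + n)) _))) := by
  -- the similitude scalars `c = a′ ⊗ 1`, `c′ = a′⁻¹ ⊗ 1`, `c c′ = 1`
  have hcc' : algebraMap (Fp L) (AdeleRing (𝓞 (Fp L)) (Fp L)) (a' : Fp L) *
      algebraMap (Fp L) (AdeleRing (𝓞 (Fp L)) (Fp L)) ((a'⁻¹ : (↥(maximalRealSubfield L))ˣ) : Fp L) = 1 := by
    rw [← map_mul, ← Units.val_mul, mul_inv_cancel, Units.val_one, map_one]
  -- the pair Gram matrix `T₀ = (diag dD ⊗ 1) ⊗ₖ (a′ ⊗ 1)` has `det` a unit (`T₁ = reindex e₁ e₁ T₀`)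
  have hT₀ : IsUnit ((realDiagonal L (dD L e dV hdV dW hdW) (dD_conj L e dV hdV dW hdW)).map (algebraMap (Fp L) (AdeleRing (𝓞 (Fp L)) (Fp L))) ⊗ₖ
      (TW (Fp L) a').map (algebraMap (Fp L) (AdeleRing (𝓞 (Fp L)) (Fp L)))).det := by
    have h := hT₁
    rwa [show adelicGram (Fp L) e₁ (realDiagonal L (dD L e dV hdV dW hdW) (dD_conj L e dV hdV dW hdW)) (TW (Fp L) a') =
      Matrix.reindex e₁ e₁ ((realDiagonal L (dD L e dV hdV dW hdW) (dD_conj L e dV hdV dW hdW)).map (algebraMap (Fp L) (AdeleRing (𝓞 (Fp L)) (Fp L))) ⊗ₖ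
        (TW (Fp L) a').map (algebraMap (Fp L) (AdeleRing (𝓞 (Fp L)) (Fp L)))) from rfl, Matrix.det_reindex_self] at h
  -- step 1: through `spReindex e₁` and the pair (K-b)
  have h1 : untransportSp (adelicGram (Fp L) e₁ (realDiagonal L (dD L e dV hdV dW hdW) (dD_conj L e dV hdV dW hdW)) (TW (Fp L) a')) hT₁
        (toSp (Fp L) L (IsCMField.complexConj L) (n + n) 1 e₁ (Matrix.diagonal (dD L e dV hdV dW hdW)) JW
          (complexConj_imagUnit L) (imagUnit_ne_zero L) (imagUnit_mul_self L) hV hW hJV hJW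
          (UnitaryGroup.adelicInl (Fp L) L (IsCMField.complexConj L) (n + n) 1 (Matrix.diagonal (dD L e dV hdV dW hdW)) JW
            (toDiagA L e dV hdV dW hdW h))) =
      spMatrixReindex e₁ (untransportSp _ hT₀
        (UnitaryGroup.adelicPairToSymplectic (Fp L) L (IsCMField.complexConj L) (n + n) 1
          (complexConj_imagUnit L) (imagUnit_ne_zero L) (imagUnit_mul_self L) hV hW hJV hJW
          (UnitaryGroup.adelicInl (Fp L) L (IsCMField.complexConj L) (n + n) 1 (Matrix.diagonal (dD L e dV hdV dW hdW)) JW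
            (toDiagA L e dV hdV dW hdW h)))) :=
    untransportSp_spReindex e₁ _ hT₀ hT₁ _
  rw [h1, coe_spMatrixReindex, coe_untransportSp_adelicPairToSymplectic, coe_adelicInl, coe_toDiagA, kronecker_one_fin_one,
    lineGram_inv_eq_reindex L e dV hdV hdV0 dW hdW hdW0, lineGram_eq_reindex]
  -- step 2: every block is `reindex p⁻¹ p⁻¹` of a block over `Fin (n + n)` (`map`, `•`, `*` commute with `reindex`)
  have hmap : ∀ f : AdeleRing (𝓞 L) L → AdeleRing (𝓞 (Fp L)) (Fp L),
      (Matrix.reindex (Equiv.prodUnique (Fin (n + n)) (Fin 1)).symm (Equiv.prodUnique (Fin (n + n)) (Fin 1)).symm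
          ((h : GL (Fin (n + n)) (AdeleRing (𝓞 L) L)) : Matrix (Fin (n + n)) (Fin (n + n)) (AdeleRing (𝓞 L) L))).map f =
        Matrix.reindex (Equiv.prodUnique (Fin (n + n)) (Fin 1)).symm (Equiv.prodUnique (Fin (n + n)) (Fin 1)).symm
          (((h : GL (Fin (n + n)) (AdeleRing (𝓞 L) L)) : Matrix (Fin (n + n)) (Fin (n + n)) (AdeleRing (𝓞 L) L)).map f) := fun f => rfl
  rw [hmap, hmap]
  simp only [reindex_mul_reindex, reindex_smul']
  rw [reindex_sumCongr_fromBlocks_reindex, coe_untransportSp_toSpD L e dV hdV hdV0 dW hdW hdW0, diag_mul_fromBlocks_mul_diag hcc']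
  congr 1
  rw [Matrix.fromBlocks_inj]
  refine ⟨rfl, ?_, ?_, ?_⟩
  · rw [Matrix.mul_smul, smul_comm]
  · rw [Matrix.smul_mul]
  · rw [Matrix.smul_mul, Matrix.mul_smul, Matrix.smul_mul, smul_smul,
      mul_comm (algebraMap (Fp L) (AdeleRing (𝓞 (Fp L)) (Fp L)) ((a'⁻¹ : (↥(maximalRealSubfield L))ˣ) : Fp L)), hcc', one_smul]

end Line


/-! ## §3 The line Cayley mover `κ′ = ρ (D_{a′} κ_n D_{a′⁻¹})` is symplectic (over any ring with `⅟2`) -/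

section Mover

open Literature.NumberTheory.GelbartRogawski1991.UnitaryDualPair.LocalSplitting (reindex_sumCongr_mem_symplecticGroup)

variable (K : Type*) [CommRing K] [Invertible (2 : K)] (n : ℕ) {n'' : ℕ} (e₁' : Fin (n + n) ≃ Fin n'')

/-- **THE LINE CAYLEY MOVER IS SYMPLECTIC**: `κ′ := reindex (e₁′ ⊕ e₁′) (D_c · κ_n · D_{c′}) ∈ Sp_{2n″}(K)` for `c c′ = 1` (`κ_n = reindex (e₂ ⊕ e₂) κ` ★ `K2LiuCayleyMoverFin`;
a similitude conjugate of a symplectic matrix, §0, re-enumerated).  At `K = L⁺`, `c = a′` this is the RATIONAL mover `κ′` of the line pair; at `K = 𝔸_{L⁺}` its adelic image.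
[cite: Kudla1994, §3] [cite: MoeglinVignerasWaldspurger1987, Chap. 2 II.2] -/
theorem lineCayleyMover_mem_symplecticGroup {c c' : K} (hcc' : c * c' = 1) :
    Matrix.reindex (e₁'.sumCongr e₁') (e₁'.sumCongr e₁')
        (Matrix.fromBlocks 1 0 0 (c • (1 : Matrix (Fin (n + n)) (Fin (n + n)) K)) *
          Matrix.reindex ((e₂ (n := n)).sumCongr (e₂ (n := n))) ((e₂ (n := n)).sumCongr (e₂ (n := n))) (cayleyMoverMatrix K (Fin n)) *
          Matrix.fromBlocks 1 0 0 (c' • (1 : Matrix (Fin (n + n)) (Fin (n + n)) K))) ∈ Matrix.symplecticGroup (Fin n'') K :=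
  reindex_sumCongr_mem_symplecticGroup e₁' K (diag_conj_mem_symplecticGroup hcc' (reindex_cayleyMoverMatrix_mem_symplecticGroup K n))

omit [Invertible (2 : K)] in
/-- `(c • 1) ⊗ 1 = (c ⊗ 1) • 1` under an entrywise ring map. [folklore] -/
theorem map_smul_one {K' : Type*} [CommRing K'] {m : Type*} [DecidableEq m] (f : K →+* K') (c : K) :
    (c • (1 : Matrix m m K)).map f = f c • (1 : Matrix m m K') := by
  rw [Matrix.smul_one_eq_diagonal, Matrix.diagonal_map (map_zero f), Matrix.smul_one_eq_diagonal]

omit [Invertible (2 : K)] in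
/-- `D_c ⊗ 1 = D_{c ⊗ 1}` under an entrywise ring map. [folklore] -/
theorem map_diag {K' : Type*} [CommRing K'] (f : K →+* K') (c : K) :
    (Matrix.fromBlocks (1 : Matrix (Fin (n + n)) (Fin (n + n)) K) 0 0 (c • (1 : Matrix (Fin (n + n)) (Fin (n + n)) K))).map f =
      Matrix.fromBlocks (1 : Matrix (Fin (n + n)) (Fin (n + n)) K') 0 0 (f c • (1 : Matrix (Fin (n + n)) (Fin (n + n)) K')) := by
  simp only [Matrix.fromBlocks_map, Matrix.map_one, Matrix.map_zero, map_zero, map_one, map_smul_one]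

/-- **THE LINE CAYLEY MOVER IS DEFINED OVER `K`**: entrywise ring maps `f` carry `κ′(c, c′)` to `κ′(f c, f c′)` (★ `reindex_cayleyMoverMatrix_map`); so the adelic `κ′` is the
`mapHom`-image of the rational one (`coe_mapHom`), the shape ★ `ratSp = transportSp ∘ mapHom` consumes. [cite: Kudla1994, §3] -/
theorem map_lineCayleyMover {K' : Type*} [CommRing K'] [Invertible (2 : K')] (f : K →+* K') (c c' : K) :
    (Matrix.reindex (e₁'.sumCongr e₁') (e₁'.sumCongr e₁')
        (Matrix.fromBlocks 1 0 0 (c • (1 : Matrix (Fin (n + n)) (Fin (n + n)) K)) *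
          Matrix.reindex ((e₂ (n := n)).sumCongr (e₂ (n := n))) ((e₂ (n := n)).sumCongr (e₂ (n := n))) (cayleyMoverMatrix K (Fin n)) *
          Matrix.fromBlocks 1 0 0 (c' • (1 : Matrix (Fin (n + n)) (Fin (n + n)) K)))).map f =
      Matrix.reindex (e₁'.sumCongr e₁') (e₁'.sumCongr e₁')
        (Matrix.fromBlocks 1 0 0 (f c • (1 : Matrix (Fin (n + n)) (Fin (n + n)) K')) *
          Matrix.reindex ((e₂ (n := n)).sumCongr (e₂ (n := n))) ((e₂ (n := n)).sumCongr (e₂ (n := n))) (cayleyMoverMatrix K' (Fin n)) *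
          Matrix.fromBlocks 1 0 0 (f c' • (1 : Matrix (Fin (n + n)) (Fin (n + n)) K'))) := by
  rw [K2LiuCayleyMoverFin.reindex_sumCongr_map, Matrix.map_mul, Matrix.map_mul, map_diag, map_diag, reindex_cayleyMoverMatrix_map]

/-- the `mapHom` form: `↑(mapHom f ⟨κ′(c, c′), _⟩) = κ′(f c, f c′)`. [cite: Kudla1994, §3] -/
theorem coe_mapHom_lineCayleyMover {K' : Type*} [CommRing K'] [Invertible (2 : K')] (f : K →+* K') {c c' : K} (hcc' : c * c' = 1) :
    ((mapHom f ⟨_, lineCayleyMover_mem_symplecticGroup K n e₁' hcc'⟩ : Matrix.symplecticGroup (Fin n'') K') :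
        Matrix (Fin n'' ⊕ Fin n'') (Fin n'' ⊕ Fin n'') K') =
      Matrix.reindex (e₁'.sumCongr e₁') (e₁'.sumCongr e₁')
        (Matrix.fromBlocks 1 0 0 (f c • (1 : Matrix (Fin (n + n)) (Fin (n + n)) K')) *
          Matrix.reindex ((e₂ (n := n)).sumCongr (e₂ (n := n))) ((e₂ (n := n)).sumCongr (e₂ (n := n))) (cayleyMoverMatrix K' (Fin n)) *
          Matrix.fromBlocks 1 0 0 (f c' • (1 : Matrix (Fin (n + n)) (Fin (n + n)) K'))) := by
  rw [coe_mapHom]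
  exact map_lineCayleyMover K n e₁' f c c'

end Mover

end Summit.HodgeConjecture.HodgeConjecture.Cruxes.HLiu418.K2LiuLinePairCayleySiegel

end
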